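import Mathlib
import Summits.Ventures.HodgeRepro2.T5SchurRepresentation

/-!
# Schur's lemma from one finite-dimensional `K`-isotypic component (the record's (s3) argument)

Blind cell `pub-hodge-repro2`, seat p8 (gen 5), Tier-5 kernel support.  The record
(route/T5-N3-route-2.md §N3.12.4 step (s3)) proves `End_{(𝔤,K)}(ρ) = ℂ` for an irreducible
admissible `(𝔤,K)`-module `ρ` as follows: «an endomorphism preserves each `K`-isotypic component,
finite-dimensional by admissibility, has an eigenvalue `c` there, and the kernel of `φ − c` is a
non-zero submodule, hence everything».  `T5SchurEigenvalue` (p392299) kernel-checked this with an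
abstract stable subspace; this file states it for REPRESENTATIONS with the `K`-isotypic component
taken literally, as Mathlib's `isotypicComponent` of the restriction to a subgroup `K`:

* `exists_smul_eq_of_stable` — an equivariant endomorphism `f` of an irreducible representation
  (`IsSimpleModule k[G] ρ.asModule`) over an algebraically closed `k` preserving a non-zero
  finite-dimensional `k`-subspace `W` is a scalar (eigenvector `w ∈ W`; `Ker (f − c)` is a
  `k[G]`-submodule containing `w ≠ 0`, hence everything);
* `isotypicSubspace ρ K τ` — the `τ`-isotypic component of `ρ|_K` (Mathlib's
  `isotypicComponent k[K] (ρ|_K).asModule τ`, `τ` a simple `k[K]`-module) as a `k`-subspace of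
  `V`; `isotypicSubspace_stable` — it is preserved by every `G`-equivariant endomorphism
  (Mathlib's `LinearMap.le_comap_isotypicComponent`: isotypic components are fully invariant);
* `exists_smul_eq_of_isotypicSubspace` — **the record's (s3)**: if some `τ`-isotypic component
  of `ρ|_K` is non-zero and finite-dimensional, every `G`-equivariant endomorphism of the
  irreducible `ρ` is a scalar; `…_complex` instance.

In the record: `G` = the group (or its `(𝔤,K)`-Hecke-algebra avatar), `K` the maximal compact,
`τ` a `K`-type occurring in `ρ`; admissibility = every `K`-isotypic component finite-dimensional
(the hypothesis here, for ONE `τ` with a non-zero component).  What stays prose: that the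
`(𝔤,K)`-module structure is a `G`-representation in this sense (or the evident translation to the
Hecke-algebra module), and admissibility itself.

README §8(d): uses an L-value-free non-vanishing device: NO.
-/

namespace Summit.Ventures.HodgeRepro2.T5SchurIsotypicComponent

open Summit.Ventures.HodgeRepro2.T5SchurRepresentation
open Summit.Ventures.HodgeRepro2.LevelPositivity (restrict)

variable {G : Type*} [Group G] {k V : Type*} [Field k] [AddCommGroup V] [Module k V]
  (ρ : Representation k G V)

/-- **Schur by an eigenvalue, representation form.** Over an algebraically closed field, a
`G`-equivariant endomorphism of an irreducible representation that preserves a non-zero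
finite-dimensional subspace is a scalar. -/
theorem exists_smul_eq_of_stable [IsAlgClosed k] [IsSimpleModule (MonoidAlgebra k G) ρ.asModule]
    (W : Submodule k V) (hW : W ≠ ⊥) [FiniteDimensional k W] (f : V →ₗ[k] V)
    (hf : ∀ g v, f (ρ g v) = ρ g (f v)) (hstab : ∀ w ∈ W, f w ∈ W) :
    ∃ c : k, ∀ v, f v = c • v := by
  -- an eigenvector `w ≠ 0` of `f` on `W`
  let fW : Module.End k W := f.restrict hstab
  have : Nontrivial W := Submodule.nontrivial_iff_ne_bot.mpr hW
  obtain ⟨c, hc⟩ := Module.End.exists_eigenvalue fW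
  obtain ⟨w, hw⟩ := hc.exists_hasEigenvector
  have hw0 : (w : V) ≠ 0 := fun h => hw.2 (Subtype.ext h)
  have hwc : f w = c • (w : V) := by
    have h2 := congrArg Subtype.val hw.apply_eq_smul
    simpa [fW, LinearMap.restrict_apply] using h2
  -- `g := f - c` is equivariant; its kernel is a `k[G]`-submodule containing `w`
  let g : V →ₗ[k] V := f - c • LinearMap.id
  have hg : ∀ x v, g (ρ x v) = ρ x (g v) := by
    intro x v
    simp only [g, LinearMap.sub_apply, LinearMap.smul_apply, LinearMap.id_apply, hf, map_sub,
      map_smul]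
  have hgw : g w = 0 := by
    simp only [g, LinearMap.sub_apply, LinearMap.smul_apply, LinearMap.id_apply, hwc, sub_self]
  let φ := toAsModuleEnd ρ g hg
  have hker : LinearMap.ker φ = ⊤ := by
    rcases eq_bot_or_eq_top (LinearMap.ker φ) with h | h
    · exfalso
      have hmem : ρ.asModuleEquiv.symm w ∈ LinearMap.ker φ := by
        rw [LinearMap.mem_ker]
        apply ρ.asModuleEquiv.injective
        rw [toAsModuleEnd_apply, LinearEquiv.apply_symm_apply, map_zero, hgw]
      rw [h, Submodule.mem_bot, LinearEquiv.map_eq_zero_iff] at hmem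
      exact hw0 hmem
    · exact h
  refine ⟨c, fun v => ?_⟩
  have hv : ρ.asModuleEquiv.symm v ∈ LinearMap.ker φ := by
    rw [hker]
    exact Submodule.mem_top
  rw [LinearMap.mem_ker] at hv
  have h3 := congrArg ρ.asModuleEquiv hv
  rw [toAsModuleEnd_apply, LinearEquiv.apply_symm_apply, map_zero] at h3
  simpa [g, sub_eq_zero] using h3

section IsotypicComponent

variable (K : Subgroup G) (τ : Type*) [AddCommGroup τ] [Module (MonoidAlgebra k K) τ]

/-- The `τ`-isotypic component of the restriction `ρ|_K` (`LevelPositivity.restrict ρ K`; Mathlib's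
`isotypicComponent` of the `k[K]`-module `(ρ|_K).asModule`), as a `k`-subspace of `V`. -/
noncomputable def isotypicSubspace : Submodule k V :=
  ((isotypicComponent (MonoidAlgebra k K) (restrict ρ K).asModule τ).restrictScalars k).map
    (restrict ρ K).asModuleEquiv.toLinearMap

/-- A `G`-equivariant endomorphism preserves every `K`-isotypic component (isotypic components
are fully invariant: Mathlib's `LinearMap.le_comap_isotypicComponent`). -/
theorem isotypicSubspace_stable [IsSimpleModule (MonoidAlgebra k K) τ] (f : V →ₗ[k] V)
    (hf : ∀ g v, f (ρ g v) = ρ g (f v)) :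
    ∀ w ∈ isotypicSubspace ρ K τ, f w ∈ isotypicSubspace ρ K τ := by
  rintro w ⟨x, hx, rfl⟩
  have hfK : ∀ (g : K) (v : V), f ((restrict ρ K) g v) = (restrict ρ K) g (f v) :=
    fun g v => hf (g : G) v
  refine ⟨toAsModuleEnd (restrict ρ K) f hfK x, ?_, toAsModuleEnd_apply _ f hfK x⟩
  have hx' : x ∈ isotypicComponent (MonoidAlgebra k K) (restrict ρ K).asModule τ := hx
  exact (LinearMap.le_comap_isotypicComponent τ (toAsModuleEnd (restrict ρ K) f hfK) hx' :)

/-- **The record's (s3).** If some `K`-isotypic component of the irreducible representation `ρ`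
is non-zero and finite-dimensional, every `G`-equivariant endomorphism of `ρ` is a scalar. -/
theorem exists_smul_eq_of_isotypicSubspace [IsAlgClosed k]
    [IsSimpleModule (MonoidAlgebra k G) ρ.asModule] [IsSimpleModule (MonoidAlgebra k K) τ]
    (hne : isotypicSubspace ρ K τ ≠ ⊥) [FiniteDimensional k (isotypicSubspace ρ K τ)]
    (f : V →ₗ[k] V) (hf : ∀ g v, f (ρ g v) = ρ g (f v)) : ∃ c : k, ∀ v, f v = c • v :=
  exists_smul_eq_of_stable ρ (isotypicSubspace ρ K τ) hne f hf (isotypicSubspace_stable ρ K τ f hf)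

/-- The same for Mathlib's `Representation.IsIrreducible`. -/
theorem exists_smul_eq_of_isotypicSubspace_of_isIrreducible [IsAlgClosed k] [ρ.IsIrreducible]
    [IsSimpleModule (MonoidAlgebra k K) τ] (hne : isotypicSubspace ρ K τ ≠ ⊥)
    [FiniteDimensional k (isotypicSubspace ρ K τ)] (f : V →ₗ[k] V)
    (hf : ∀ g v, f (ρ g v) = ρ g (f v)) : ∃ c : k, ∀ v, f v = c • v :=
  exists_smul_eq_of_isotypicSubspace ρ K τ hne f hf

end IsotypicComponent

section Complex

variable {V' : Type*} [AddCommGroup V'] [Module ℂ V'] (ρ' : Representation ℂ G V')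

/-- **The record's (s3) over `ℂ`.** -/
theorem exists_smul_eq_of_isotypicSubspace_complex [IsSimpleModule (MonoidAlgebra ℂ G) ρ'.asModule]
    (K : Subgroup G) (τ : Type*) [AddCommGroup τ] [Module (MonoidAlgebra ℂ K) τ]
    [IsSimpleModule (MonoidAlgebra ℂ K) τ] (hne : isotypicSubspace ρ' K τ ≠ ⊥)
    [FiniteDimensional ℂ (isotypicSubspace ρ' K τ)] (f : V' →ₗ[ℂ] V')
    (hf : ∀ g v, f (ρ' g v) = ρ' g (f v)) : ∃ c : ℂ, ∀ v, f v = c • v :=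
  exists_smul_eq_of_isotypicSubspace ρ' K τ hne f hf

end Complex

end Summit.Ventures.HodgeRepro2.T5SchurIsotypicComponent
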